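import Mathlib.Analysis.SpecialFunctions.Trigonometric.DerivHyp
import Mathlib.Analysis.SpecialFunctions.Log.Deriv
import Mathlib.Analysis.Calculus.Deriv.MeanValue
import Literature.Barriers.HubbardSuperconductivity.WeakCouplingCeiling
import HarnessLib

/-!
# Elementary bounds for the BdG pressure gain: `log cosh b - log cosh a`

Topic `MathematicalPhysics/QuantumLattice` (real-analysis lemmas for the free `d`-wave sourced
pressure of the Hubbard torus, `DWaveSourceFreePressure.lean`). For `0 ≤ a ≤ b`:

* `log_cosh_sub_log_cosh_le_sub` — `log cosh b - log cosh a ≤ b - a` (from `cosh b ≤ e^{b-a} cosh a`);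
* (`sinh y ≤ y cosh y`, i.e. `tanh y ≤ y`, is the barrier file's `sinh_le_self_mul_cosh`);
* `monotoneOn_half_sq_sub_log_cosh` — `y ↦ y²/2 - log cosh y` is nondecreasing on `[0, ∞)`, hence
  `log_cosh_sub_log_cosh_le_half_sq_sub` — `log cosh b - log cosh a ≤ (b² - a²)/2`;
* `one_add_cosh` — `1 + cosh y = 2 cosh²(y/2)`;
* **`bdgModeGain_le`** — the per-mode gain of the BdG pressure,
  `log((1 + cosh(β√(ξ²+D²)))/2) - log((1 + cosh(βξ))/2) ≤ β D² · β/(2 + β|ξ|)` for `β > 0`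
  (`≍ βD² min(β/2, 1/|ξ|)`: temperature-cutoff `βD²·β` for `|ξ| ≲ 1/β`, Cooper-type `βD²/|ξ|` above).

Folklore calculus (e.g. the estimates behind Salmhofer, *Renormalization* (1999) §4.5.4,
(4.200)–(4.203), `tanh(βE/2)/(2E)`); no definition, no named fact.
-/

noncomputable section

namespace Literature.MathematicalPhysics.QuantumLattice

open Real Set Literature.Barriers.HubbardSuperconductivity

/-- `cosh b ≤ e^{b-a} cosh a` for `a ≤ b`. [folklore] -/
theorem cosh_le_exp_sub_mul_cosh {a b : ℝ} (hab : a ≤ b) : Real.cosh b ≤ Real.exp (b - a) * Real.cosh a := by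
  rw [Real.cosh_eq, Real.cosh_eq, mul_div_assoc', mul_add, ← Real.exp_add, ← Real.exp_add,
    show b - a + a = b by ring, show b - a + -a = b - 2 * a by ring]
  gcongr
  linarith

/-- **`log cosh b - log cosh a ≤ b - a`** for `a ≤ b`. [folklore] -/
theorem log_cosh_sub_log_cosh_le_sub {a b : ℝ} (hab : a ≤ b) :
    Real.log (Real.cosh b) - Real.log (Real.cosh a) ≤ b - a := by
  have ha := Real.cosh_pos a
  have hb := Real.cosh_pos b
  have h := Real.log_le_log hb (cosh_le_exp_sub_mul_cosh hab)
  rw [Real.log_mul (Real.exp_pos _).ne' ha.ne', Real.log_exp] at h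
  linarith

/-- `y ↦ y²/2 - log cosh y` is nondecreasing on `[0, ∞)` (derivative `y - tanh y ≥ 0`). [folklore] -/
theorem monotoneOn_half_sq_sub_log_cosh :
    MonotoneOn (fun y => y ^ 2 / 2 - Real.log (Real.cosh y)) (Ici 0) := by
  have hderiv : ∀ x, HasDerivAt (fun y => y ^ 2 / 2 - Real.log (Real.cosh y))
      (x - Real.sinh x / Real.cosh x) x := by
    intro x
    have h1 : HasDerivAt (fun y => y ^ 2 / 2) x x :=
      ((hasDerivAt_pow 2 x).div_const 2).congr_deriv (by norm_num)
    have h2 : HasDerivAt (fun y => Real.log (Real.cosh y)) (Real.sinh x / Real.cosh x) x :=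
      (Real.hasDerivAt_cosh x).log (Real.cosh_pos x).ne'
    exact h1.sub h2
  refine monotoneOn_of_deriv_nonneg (convex_Ici 0) ?_ ?_ ?_
  · exact HasDerivAt.continuousOn fun x _ => hderiv x
  · exact fun x _ => (hderiv x).differentiableAt.differentiableWithinAt
  · intro x hx
    rw [interior_Ici, mem_Ioi] at hx
    rw [(hderiv x).deriv, sub_nonneg, div_le_iff₀ (Real.cosh_pos x)]
    exact sinh_le_self_mul_cosh hx.le

/-- **`log cosh b - log cosh a ≤ (b² - a²)/2`** for `0 ≤ a ≤ b`. [folklore] -/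
theorem log_cosh_sub_log_cosh_le_half_sq_sub {a b : ℝ} (ha : 0 ≤ a) (hab : a ≤ b) :
    Real.log (Real.cosh b) - Real.log (Real.cosh a) ≤ (b ^ 2 - a ^ 2) / 2 := by
  have h := monotoneOn_half_sq_sub_log_cosh (mem_Ici.2 ha) (mem_Ici.2 (ha.trans hab)) hab
  simp only at h
  linarith

/-- The half-angle identity `1 + cosh y = 2 cosh²(y/2)`. [folklore] -/
theorem one_add_cosh (y : ℝ) : 1 + Real.cosh y = 2 * Real.cosh (y / 2) ^ 2 := by
  have h := Real.cosh_two_mul (y / 2)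
  rw [show 2 * (y / 2) = y by ring] at h
  nlinarith [Real.cosh_sq (y / 2)]

/-- `log((1 + cosh y)/2) = 2 log cosh(y/2)`. [folklore] -/
theorem log_one_add_cosh_div_two (y : ℝ) :
    Real.log ((1 + Real.cosh y) / 2) = 2 * Real.log (Real.cosh (y / 2)) := by
  rw [one_add_cosh, mul_div_cancel_left₀ _ two_ne_zero, Real.log_pow]
  norm_num

/-- **Per-mode gain of the BdG pressure.** For `β > 0` and real `ξ, D`,
`log((1 + cosh(β√(ξ² + D²)))/2) - log((1 + cosh(βξ))/2) ≤ β D² · β/(2 + β|ξ|)`.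
(With `a = β|ξ|/2 ≤ b = βE/2`, `E = √(ξ²+D²)`: the left side is `2(log cosh b - log cosh a)`,
`b² - a² = β²D²/4`, and `2·min(b - a, (b²-a²)/2) ≤ βD²·β/(2 + β|ξ|)`.) [folklore] -/
theorem bdgModeGain_le {β : ℝ} (hβ : 0 < β) (ξ D : ℝ) :
    Real.log ((1 + Real.cosh (β * Real.sqrt (ξ ^ 2 + D ^ 2))) / 2) -
        Real.log ((1 + Real.cosh (β * ξ)) / 2) ≤ β * D ^ 2 * (β / (2 + β * |ξ|)) := by
  set E := Real.sqrt (ξ ^ 2 + D ^ 2) with hE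
  have hE0 : 0 ≤ E := Real.sqrt_nonneg _
  have hEsq : E ^ 2 = ξ ^ 2 + D ^ 2 := Real.sq_sqrt (by positivity)
  have hξE : |ξ| ≤ E := by
    rw [hE, ← Real.sqrt_sq_eq_abs]
    exact Real.sqrt_le_sqrt (by nlinarith [sq_nonneg D])
  -- rewrite both logs through `cosh(·/2)` and `cosh(βξ) = cosh(β|ξ|)`
  have hcosh_abs : Real.cosh (β * ξ) = Real.cosh (β * |ξ|) := by
    rcases abs_choice ξ with h | h
    · rw [h]
    · rw [h, mul_neg, Real.cosh_neg]
  rw [hcosh_abs, log_one_add_cosh_div_two, log_one_add_cosh_div_two]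
  set a := β * |ξ| / 2 with ha
  set b := β * E / 2 with hb
  have ha0 : 0 ≤ a := by positivity
  have hab : a ≤ b := by
    rw [ha, hb]
    gcongr
  have hsq : b ^ 2 - a ^ 2 = β ^ 2 * D ^ 2 / 4 := by
    rw [hb, ha, div_pow, div_pow, mul_pow, mul_pow, hEsq, sq_abs]
    ring
  have h1 := log_cosh_sub_log_cosh_le_sub hab
  have h2 := log_cosh_sub_log_cosh_le_half_sq_sub ha0 hab
  have hden : 0 < 2 + β * |ξ| := by positivity
  have hβD : 0 ≤ β * D ^ 2 := by positivity
  by_cases hsmall : β * |ξ| ≤ 2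
  · -- quadratic bound: `2·(b²-a²)/2 = β²D²/4 = βD²·(β/4) ≤ βD²·β/(2+β|ξ|)`
    have hw : β / 4 ≤ β / (2 + β * |ξ|) :=
      div_le_div_of_nonneg_left hβ.le hden (by linarith)
    calc 2 * Real.log (Real.cosh b) - 2 * Real.log (Real.cosh a)
        ≤ b ^ 2 - a ^ 2 := by linarith
      _ = β * D ^ 2 * (β / 4) := by rw [hsq]; ring
      _ ≤ β * D ^ 2 * (β / (2 + β * |ξ|)) := mul_le_mul_of_nonneg_left hw hβD
  · -- linear bound: `2(b-a) ≤ (b²-a²)/a = βD²/(2|ξ|) ≤ βD²·β/(2+β|ξ|)` since `β|ξ| > 2`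
    rw [not_le] at hsmall
    have hξpos : 0 < |ξ| := by
      rcases (abs_nonneg ξ).eq_or_lt with h0 | h0
      · rw [← h0, mul_zero] at hsmall; linarith
      · exact h0
    have hapos : 0 < a := by rw [ha]; positivity
    have hba : 2 * (b - a) ≤ (b ^ 2 - a ^ 2) / a := by
      rw [le_div_iff₀ hapos]
      nlinarith
    have hw : 1 / (2 * |ξ|) ≤ β / (2 + β * |ξ|) := by
      rw [div_le_div_iff₀ (by positivity) hden]
      nlinarith
    calc 2 * Real.log (Real.cosh b) - 2 * Real.log (Real.cosh a)
        ≤ (b ^ 2 - a ^ 2) / a := by linarith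
      _ = β * D ^ 2 * (1 / (2 * |ξ|)) := by
          rw [hsq, ha]
          field_simp
          ring
      _ ≤ β * D ^ 2 * (β / (2 + β * |ξ|)) := mul_le_mul_of_nonneg_left hw hβD

end Literature.MathematicalPhysics.QuantumLattice
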